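import Summits.CriticalPhenomena.PercolationContinuityZ3.Theorems.FK.OSSSLatticeIncidence
import Summits.CriticalPhenomena.PercolationContinuityZ3.Theorems.FK.CylinderEdgeConditioning
import Summits.CriticalPhenomena.PercolationContinuityZ3.Theorems.FK.DomainMarkovExtremality
import Summits.CriticalPhenomena.PercolationContinuityZ3.Theorems.FK.SteepnessFK
import HarnessLib

/-!
# The wired random-cluster law of `Λ_N` read on the edges of `Λ_n` as a strictly positive FKG-lattice weight on the
# cube `ι_n → Bool` (Duminil-Copin–Raoufi–Tassion 2019, §3: the measure `μ_n = φ^w_{Λ_{2n}}` of the proof of Thm 1.2)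

Claimed R42 (8)(c) in the cell INBOX at 2026-08-28T02:11:55Z by fkp-10a gen 352 (NEW CLAIM #2 of the gen), addressed to coordinator fk-4 g266 (seated 01:27Z 2026-08-28; R146 l.8252: row FO-10a-g352 = package g352-osss; its (κ) clause sends the FK instantiation to a new claim, R147); lineage row FO-10a-g352f (self-suggested), package g352-fkosss, label FS-C.
Support file of the `fk-continuity` cell (lineage fkp-10a, `--supports stmt-CriticalPhenomena-4575`); builds on
p205010 (kernel theorem, internal audit signed; external expert review pending).  No definitions, no named facts,
no sorries; standard axioms.  Package `g352-fkosss` = THE FK INSTANTIATION of the OSSS inequality for monotonic measures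
(row FO-10a-g352 `g352-osss`): Duminil-Copin–Raoufi–Tassion's Theorem 1.2 (sharpness of the random-cluster phase
transition on `ℤ^d`, `q ≥ 1`) and, on `ℤ²`, `p_c(q) = √q/(1+√q)`.  UNCONDITIONAL; nothing here touches FH / TP_FK / the
`_r3` binders of the cell.

For `n ≤ N` let `μ(y) = φ¹_{Λ_N,p,q}{ω : ω =_{ι_n} y}` be the law of the read-out `ω ↦ (e ↦ [e ∈ ω])`, `e ∈ ι_n = edgesIn ℤ^d Λ_n`,
under the WIRED random-cluster measure of `Λ_N` (the tree's `regionWiredReal`).  `μ` is a VARIABLE pinned by this equation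
(`hμ`; no definition).  Proved: cube sums against indicators are `φ¹_{Λ_N}`-probabilities of read-out events
(`sum_mu_mul_ite`), `Σ μ = 1`, STRICT POSITIVITY (`0 < p < 1`, `q > 0`: every edge pattern of `Λ_n` is realised by a box
configuration of positive weight), and the FKG LATTICE CONDITION `μ(y)μ(y') ≤ μ(y ⊓ y')μ(y ⊔ y')` for `q ≥ 1` (the marginal
of an FKG-lattice weight is FKG-lattice: Ahlswede–Daykin's four functions theorem, Mathlib `four_functions_theorem_univ`,
applied to the random-cluster weight of `Λ_N` — lattice condition Grimmett Thm (3.8), the tree's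
`rcWeight_lattice_condition` — times the indicators of two read-out cylinders).  So `μ` is exactly a measure to which the
OSSS inequality for monotonic measures (`g352-osss`) applies; the dictionary between cube sums and the lineage's events
(`siteToBoundary`, `armEvent`) is in `OSSSWiredBoxVariance.lean`.  Finite sums; no definitions.

## References
* H. Duminil-Copin, A. Raoufi, V. Tassion, Ann. of Math. 189 (2019) 75–99, §3 (proof of Thm 1.2: "Since μ_n is monotonic
  [Gri06], Lemma 3.2 …"). [DuminilCopinRaoufiTassion2019]
* G. Grimmett, *The Random-Cluster Model*, Springer 2006, Thm (3.8) (FKG lattice condition), Thm (2.24), §4.2. [Grimmett2006]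
-/

noncomputable section

namespace Summit.CriticalPhenomena.PercolationContinuityZ3.Theorems.FK

namespace MonotonicOSSS

open MeasureTheory Finset Function Literature.Probability.ODonnellSaksSchrammServedio2005
open Literature.Probability.Percolation Literature.Probability.LatticeModels
open Literature.Probability.Percolation.GhostExploration Literature.Probability.Percolation.SeedExploration
open Literature.Probability.Percolation.OneArmOSSS Literature.Probability.Percolation.DCT16
open Classical

variable {d n : ℕ}

/-! ### The wired FK law of `Λ_N` read on the edges of `Λ_n` as a weight on the cube `ι_n → Bool` -/

section Cube

variable (d)

/-- `φ¹_{Λ,p,q}` as the tree's finite-volume expectation `rcExpect` of the indicator read through `liftEdges`.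
[cite: Grimmett2006, §4.2 (4.11)–(4.12)] -/
theorem regionWiredReal_eq_rcExpect {p q : ℝ} (hp : p ∈ Set.Icc (0 : ℝ) 1) (hq : 0 < q) (Λ : Finset (Site d))
    (A : Set (BondConfig (Site d))) :
    regionWiredReal d p q Λ A = rcExpect (finsetGraph (zdGraph d) Λ) p q (wiredBoundary (zdGraph d) Λ)
      (fun ω => if liftEdges Λ (↑ω : BondConfig ↥Λ) ∈ A then 1 else 0) := by
  rw [regionWiredReal, rcMeasure_real_eq_rcExpect _ hp hq]
  rfl

/-- Monotonicity of `φ¹_{Λ,p,q}` in the event. [cite: Grimmett2006, §4.2] -/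
theorem regionWiredReal_mono_set {p q : ℝ} (hp : p ∈ Set.Icc (0 : ℝ) 1) (hq : 0 < q) (Λ : Finset (Site d))
    {A A' : Set (BondConfig (Site d))} (h : A ⊆ A') :
    regionWiredReal d p q Λ A ≤ regionWiredReal d p q Λ A' := by
  haveI := isProbabilityMeasure_rcMeasure (finsetGraph (zdGraph d) Λ) hp hq (wiredBoundary (zdGraph d) Λ)
  rw [regionWiredReal, regionWiredReal]
  exact measureReal_mono (Set.preimage_mono h) (measure_ne_top _ _)

/-- Events agreeing on configurations of lattice edges have the same `φ¹_{Λ,p,q}`-probability.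
[cite: Grimmett2006, §4.2 (4.11) (Ω_Λ: configurations of E_Λ)] -/
theorem regionWiredReal_congr_lattice {p q : ℝ} (hp : p ∈ Set.Icc (0 : ℝ) 1) (hq : 0 < q) (Λ : Finset (Site d))
    {A A' : Set (BondConfig (Site d))} (h : ∀ ω ⊆ (zdGraph d).edgeSet, ω ∈ A ↔ ω ∈ A') :
    regionWiredReal d p q Λ A = regionWiredReal d p q Λ A' := by
  rw [← regionWiredReal_preimage_inter_edgeSet hp hq Λ A, ← regionWiredReal_preimage_inter_edgeSet hp hq Λ A']
  congr 1
  ext ω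
  exact h _ Set.inter_subset_right

/-- `φ¹_{Λ,p,q}` of the whole space is `1`. [cite: Grimmett2006, §4.2 (4.12)] -/
theorem regionWiredReal_univ {p q : ℝ} (hp : p ∈ Set.Icc (0 : ℝ) 1) (hq : 0 < q) (Λ : Finset (Site d)) :
    regionWiredReal d p q Λ Set.univ = 1 := by
  haveI := isProbabilityMeasure_rcMeasure (finsetGraph (zdGraph d) Λ) hp hq (wiredBoundary (zdGraph d) Λ)
  rw [regionWiredReal, Set.preimage_univ, probReal_univ]

variable {d}

/-- The read-out of the lifted configuration lies in the cylinder of `y` iff it equals `y`. [folklore] -/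
theorem readout_eq_iff (ω : BondConfig (Site d)) (y : ↥(edgesIn (zdGraph d) (box d n)) → Bool) :
    (fun e : ↥(edgesIn (zdGraph d) (box d n)) => decide (e.1 ∈ ω)) = y
      ↔ ∀ e : ↥(edgesIn (zdGraph d) (box d n)), (e.1 ∈ ω ↔ y e = true) := by
  rw [funext_iff]
  refine forall_congr' fun e => ?_
  rcases Bool.eq_false_or_eq_true (y e) with h | h <;> simp [h]

/-- Every lattice edge of `Λ_n` is (the image of) an edge of the box graph `Λ_N`, `n ≤ N`. [cite: Grimmett2006, §4.2 (E_Λ)] -/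
theorem exists_boxEdge_map_eq {N : ℕ} (hnN : n ≤ N) (e : ↥(edgesIn (zdGraph d) (box d n))) :
    ∃ e' : Sym2 ↥(box d N), e' ∈ (finsetGraph (zdGraph d) (box d N)).edgeFinset ∧ Sym2.map Subtype.val e' = e.1 := by
  obtain ⟨z, hz⟩ := e
  revert hz
  refine Sym2.ind (fun u v => ?_) z
  intro hz
  rw [mem_edgesIn_iff] at hz
  obtain ⟨hadj, hmem⟩ := hz
  have hu : u ∈ box d N := box_mono d hnN (hmem u (Sym2.mem_mk_left u v))
  have hv : v ∈ box d N := box_mono d hnN (hmem v (Sym2.mem_mk_right u v))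
  refine ⟨s(⟨u, hu⟩, ⟨v, hv⟩), ?_, by rw [Sym2.map_mk]⟩
  rw [SimpleGraph.mem_edgeFinset, SimpleGraph.mem_edgeSet, finsetGraph_adj_iff]
  exact (SimpleGraph.mem_edgeSet _).1 hadj

/-- Lifting commutes with intersection on lattice edges of `Λ_n` (injectivity of the lift). [folklore] -/
theorem mem_liftEdges_inter_iff {N : ℕ} (a b : Finset (Sym2 ↥(box d N))) (e : Sym2 (Site d)) :
    e ∈ liftEdges (box d N) (↑(a ∩ b) : BondConfig ↥(box d N)) ↔
      e ∈ liftEdges (box d N) (↑a : BondConfig ↥(box d N)) ∧ e ∈ liftEdges (box d N) (↑b : BondConfig ↥(box d N)) := by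
  simp only [mem_liftEdges_iff, Finset.coe_inter, Set.mem_inter_iff, Finset.mem_coe]
  constructor
  · rintro ⟨e', ⟨ha, hb⟩, he⟩
    exact ⟨⟨e', ha, he⟩, ⟨e', hb, he⟩⟩
  · rintro ⟨⟨e₁, ha, h₁⟩, ⟨e₂, hb, h₂⟩⟩
    have : e₁ = e₂ := Sym2.map.injective Subtype.val_injective (h₁.trans h₂.symm)
    subst this
    exact ⟨e₁, ⟨ha, hb⟩, h₁⟩

/-- Lifting commutes with union. [folklore] -/
theorem mem_liftEdges_union_iff {N : ℕ} (a b : Finset (Sym2 ↥(box d N))) (e : Sym2 (Site d)) :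
    e ∈ liftEdges (box d N) (↑(a ∪ b) : BondConfig ↥(box d N)) ↔
      e ∈ liftEdges (box d N) (↑a : BondConfig ↥(box d N)) ∨ e ∈ liftEdges (box d N) (↑b : BondConfig ↥(box d N)) := by
  simp only [mem_liftEdges_iff, Finset.coe_union, Set.mem_union, Finset.mem_coe]
  constructor
  · rintro ⟨e', ha | hb, he⟩
    · exact Or.inl ⟨e', ha, he⟩
    · exact Or.inr ⟨e', hb, he⟩
  · rintro (⟨e', ha, he⟩ | ⟨e', hb, he⟩)
    · exact ⟨e', Or.inl ha, he⟩
    · exact ⟨e', Or.inr hb, he⟩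

/-- `(y ⊓ y')(e) = 1 ↔ y(e) = 1 ∧ y'(e) = 1` on the Boolean cube. [folklore] -/
theorem inf_apply_eq_true_iff {ι : Type*} (y y' : ι → Bool) (e : ι) :
    (y ⊓ y') e = true ↔ y e = true ∧ y' e = true := by
  rw [Pi.inf_apply]
  cases y e <;> cases y' e <;> decide

/-- `(y ⊔ y')(e) = 1 ↔ y(e) = 1 ∨ y'(e) = 1` on the Boolean cube. [folklore] -/
theorem sup_apply_eq_true_iff {ι : Type*} (y y' : ι → Bool) (e : ι) :
    (y ⊔ y') e = true ↔ y e = true ∨ y' e = true := by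
  rw [Pi.sup_apply]
  cases y e <;> cases y' e <;> decide

variable {p q : ℝ} {N : ℕ} (μ : (↥(edgesIn (zdGraph d) (box d n)) → Bool) → ℝ)

/-- CUBE SUMS ARE PROBABILITIES OF READ-OUT EVENTS: `Σ_y μ(y) 𝟙{y ∈ S} = φ¹_{Λ_N}{ω : (e ↦ [e ∈ ω]) ∈ S}`.
[cite: DuminilCopinRaoufiTassion2019, §3 proof of Thm 1.2 (μ_n as a measure on {0,1}^E)] -/
theorem sum_mu_mul_ite (hp : p ∈ Set.Icc (0 : ℝ) 1) (hq : 0 < q)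
    (hμ : ∀ y, μ y = regionWiredReal d p q (box d N)
      {ω | ∀ e : ↥(edgesIn (zdGraph d) (box d n)), (e.1 ∈ ω ↔ y e = true)})
    (S : (↥(edgesIn (zdGraph d) (box d n)) → Bool) → Prop) [DecidablePred S] :
    ∑ y, μ y * (if S y then 1 else 0)
      = regionWiredReal d p q (box d N)
        {ω | S (fun e : ↥(edgesIn (zdGraph d) (box d n)) => decide (e.1 ∈ ω))} := by
  have h1 : ∀ y : ↥(edgesIn (zdGraph d) (box d n)) → Bool, μ y * (if S y then (1 : ℝ) else 0)
      = rcExpect (finsetGraph (zdGraph d) (box d N)) p q (wiredBoundary (zdGraph d) (box d N))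
        (fun ω => if (fun e : ↥(edgesIn (zdGraph d) (box d n)) =>
            decide (e.1 ∈ liftEdges (box d N) (↑ω : BondConfig ↥(box d N)))) = y
          then (if S y then (1 : ℝ) else 0) else 0) := by
    intro y
    rw [hμ, regionWiredReal_eq_rcExpect d hp hq, mul_comm, ← rcExpect_const_mul]
    refine rcExpect_congr _ _ _ _ fun ω _ => ?_
    have hiff : liftEdges (box d N) (↑ω : BondConfig ↥(box d N))
        ∈ {ω' : BondConfig (Site d) | ∀ e : ↥(edgesIn (zdGraph d) (box d n)), (e.1 ∈ ω' ↔ y e = true)}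
        ↔ (fun e : ↥(edgesIn (zdGraph d) (box d n)) =>
            decide (e.1 ∈ liftEdges (box d N) (↑ω : BondConfig ↥(box d N)))) = y := by
      rw [Set.mem_setOf_eq, readout_eq_iff]
    by_cases h : (fun e : ↥(edgesIn (zdGraph d) (box d n)) =>
        decide (e.1 ∈ liftEdges (box d N) (↑ω : BondConfig ↥(box d N)))) = y
    · rw [if_pos h, if_pos (hiff.2 h), mul_one]
    · rw [if_neg h, if_neg (fun h' => h (hiff.1 h')), mul_zero]
  rw [Finset.sum_congr rfl fun y _ => h1 y, ← rcExpect_finset_sum, regionWiredReal_eq_rcExpect d hp hq]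
  refine rcExpect_congr _ _ _ _ fun ω _ => ?_
  rw [Finset.sum_ite_eq Finset.univ, if_pos (Finset.mem_univ _)]
  by_cases hS : S (fun e : ↥(edgesIn (zdGraph d) (box d n)) =>
      decide (e.1 ∈ liftEdges (box d N) (↑ω : BondConfig ↥(box d N))))
  · rw [if_pos hS, if_pos (show liftEdges (box d N) (↑ω : BondConfig ↥(box d N)) ∈
      {ω' : BondConfig (Site d) | S (fun e : ↥(edgesIn (zdGraph d) (box d n)) => decide (e.1 ∈ ω'))} from hS)]
  · rw [if_neg hS, if_neg (show ¬ (liftEdges (box d N) (↑ω : BondConfig ↥(box d N)) ∈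
      {ω' : BondConfig (Site d) | S (fun e : ↥(edgesIn (zdGraph d) (box d n)) => decide (e.1 ∈ ω'))}) from hS)]

/-- `Σ_y μ(y) = 1`. [cite: DuminilCopinRaoufiTassion2019, §3 proof of Thm 1.2 (μ_n is a probability measure)] -/
theorem sum_mu_eq_one (hp : p ∈ Set.Icc (0 : ℝ) 1) (hq : 0 < q)
    (hμ : ∀ y, μ y = regionWiredReal d p q (box d N)
      {ω | ∀ e : ↥(edgesIn (zdGraph d) (box d n)), (e.1 ∈ ω ↔ y e = true)}) :
    ∑ y, μ y = 1 := by
  have h := sum_mu_mul_ite μ hp hq hμ (fun _ => True)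
  simp only [if_true, mul_one, Set.setOf_true] at h
  rw [h]; exact regionWiredReal_univ d hp hq _

/-- STRICT POSITIVITY: `μ(y) > 0` for `0 < p < 1`, `q > 0`, `n ≤ N` (every edge pattern of `Λ_n` is realised by a box
configuration of positive weight). [cite: Grimmett2006, §1.2 eq. (1.2) (positive weights)] -/
theorem mu_pos (hp : p ∈ Set.Ioo (0 : ℝ) 1) (hq : 0 < q) (hnN : n ≤ N)
    (hμ : ∀ y, μ y = regionWiredReal d p q (box d N)
      {ω | ∀ e : ↥(edgesIn (zdGraph d) (box d n)), (e.1 ∈ ω ↔ y e = true)})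
    (y : ↥(edgesIn (zdGraph d) (box d n)) → Bool) : 0 < μ y := by
  set G := finsetGraph (zdGraph d) (box d N)
  rw [hμ, regionWiredReal]
  set ω₀ : Finset (Sym2 ↥(box d N)) := G.edgeFinset.filter
    (fun e' => ∃ e : ↥(edgesIn (zdGraph d) (box d n)), y e = true ∧ e.1 = Sym2.map Subtype.val e') with hω₀
  refine rcMeasure_real_pos_of_coe_mem G hp hq _ (ω₀ := ω₀) (Finset.filter_subset _ _) ?_
  rw [Set.mem_preimage, Set.mem_setOf_eq]
  intro e
  rw [mem_liftEdges_iff]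
  constructor
  · rintro ⟨e', he', hmap⟩
    rw [Finset.mem_coe, hω₀, Finset.mem_filter] at he'
    obtain ⟨_, f, hf, hfe⟩ := he'
    have : f = e := Subtype.ext (hfe.trans hmap)
    rw [← this]; exact hf
  · intro hy
    obtain ⟨e', he', hmap⟩ := exists_boxEdge_map_eq hnN e
    refine ⟨e', ?_, hmap⟩
    rw [Finset.mem_coe, hω₀, Finset.mem_filter]
    exact ⟨he', e, hy, hmap.symm⟩

/-- The mass of a read-out cylinder against the random-cluster weight of `Λ_N` is `Z · μ(z)`.
[cite: Grimmett2006, §1.2 eq. (1.2)–(1.3)] -/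
theorem sum_weight_mul_cyl (hp : p ∈ Set.Icc (0 : ℝ) 1) (hq : 0 < q)
    (hμ : ∀ y, μ y = regionWiredReal d p q (box d N)
      {ω | ∀ e : ↥(edgesIn (zdGraph d) (box d n)), (e.1 ∈ ω ↔ y e = true)})
    (z : ↥(edgesIn (zdGraph d) (box d n)) → Bool) :
    ∑ ω : Finset (Sym2 ↥(box d N)),
        (if ω ⊆ (finsetGraph (zdGraph d) (box d N)).edgeFinset
          then rcWeight (finsetGraph (zdGraph d) (box d N)) p q (wiredBoundary (zdGraph d) (box d N)) ω else 0)
        * (if (∀ e : ↥(edgesIn (zdGraph d) (box d n)),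
            (e.1 ∈ liftEdges (box d N) (↑ω : BondConfig ↥(box d N)) ↔ z e = true)) then 1 else 0)
      = rcPartitionFunction (finsetGraph (zdGraph d) (box d N)) p q (wiredBoundary (zdGraph d) (box d N)) * μ z := by
  have hZ := rcPartitionFunction_pos (finsetGraph (zdGraph d) (box d N)) hp hq (wiredBoundary (zdGraph d) (box d N))
  rw [sum_ite_rcWeight_mul _ p q _ _ hZ.ne', hμ, regionWiredReal_eq_rcExpect d hp hq]
  refine congrArg _ (rcExpect_congr _ _ _ _ fun ω _ => ?_)
  by_cases h : ∀ e : ↥(edgesIn (zdGraph d) (box d n)),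
      (e.1 ∈ liftEdges (box d N) (↑ω : BondConfig ↥(box d N)) ↔ z e = true)
  · rw [if_pos h, if_pos (show liftEdges (box d N) (↑ω : BondConfig ↥(box d N)) ∈
      {ω' : BondConfig (Site d) | ∀ e : ↥(edgesIn (zdGraph d) (box d n)), (e.1 ∈ ω' ↔ z e = true)} from h)]
  · rw [if_neg h, if_neg (show ¬ (liftEdges (box d N) (↑ω : BondConfig ↥(box d N)) ∈
      {ω' : BondConfig (Site d) | ∀ e : ↥(edgesIn (zdGraph d) (box d n)), (e.1 ∈ ω' ↔ z e = true)}) from h)]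

/-- The four-functions hypothesis for the cylinder-restricted random-cluster weights of `Λ_N`: the weight satisfies the
FKG lattice condition (Grimmett Thm (3.8)) and the cylinders of `y`, `y'` meet/join into the cylinders of `y ⊓ y'`,
`y ⊔ y'`. [cite: Grimmett2006, Thm (3.8) (FKG lattice condition (3.9))] -/
theorem cyl_weight_four_functions (hp : p ∈ Set.Icc (0 : ℝ) 1) (hq : 1 ≤ q)
    (y y' : ↥(edgesIn (zdGraph d) (box d n)) → Bool) (a b : Finset (Sym2 ↥(box d N))) :
    ((if a ⊆ (finsetGraph (zdGraph d) (box d N)).edgeFinset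
        then rcWeight (finsetGraph (zdGraph d) (box d N)) p q (wiredBoundary (zdGraph d) (box d N)) a else 0)
      * (if (∀ e : ↥(edgesIn (zdGraph d) (box d n)),
          (e.1 ∈ liftEdges (box d N) (↑a : BondConfig ↥(box d N)) ↔ y e = true)) then 1 else 0))
    * ((if b ⊆ (finsetGraph (zdGraph d) (box d N)).edgeFinset
        then rcWeight (finsetGraph (zdGraph d) (box d N)) p q (wiredBoundary (zdGraph d) (box d N)) b else 0)
      * (if (∀ e : ↥(edgesIn (zdGraph d) (box d n)),
          (e.1 ∈ liftEdges (box d N) (↑b : BondConfig ↥(box d N)) ↔ y' e = true)) then 1 else 0))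
    ≤ ((if a ⊓ b ⊆ (finsetGraph (zdGraph d) (box d N)).edgeFinset
        then rcWeight (finsetGraph (zdGraph d) (box d N)) p q (wiredBoundary (zdGraph d) (box d N)) (a ⊓ b) else 0)
      * (if (∀ e : ↥(edgesIn (zdGraph d) (box d n)),
          (e.1 ∈ liftEdges (box d N) (↑(a ⊓ b) : BondConfig ↥(box d N)) ↔ (y ⊓ y') e = true)) then 1 else 0))
    * ((if a ⊔ b ⊆ (finsetGraph (zdGraph d) (box d N)).edgeFinset
        then rcWeight (finsetGraph (zdGraph d) (box d N)) p q (wiredBoundary (zdGraph d) (box d N)) (a ⊔ b) else 0)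
      * (if (∀ e : ↥(edgesIn (zdGraph d) (box d n)),
          (e.1 ∈ liftEdges (box d N) (↑(a ⊔ b) : BondConfig ↥(box d N)) ↔ (y ⊔ y') e = true)) then 1 else 0)) := by
  have hq0 : (0 : ℝ) ≤ q := zero_le_one.trans hq
  set G := finsetGraph (zdGraph d) (box d N)
  set B := wiredBoundary (zdGraph d) (box d N)
  have hw0 : ∀ ω, 0 ≤ (if ω ⊆ G.edgeFinset then rcWeight G p q B ω else 0) := fun ω => rcWeight_ite_nonneg G hp hq0 B ω
  by_cases ha : ∀ e : ↥(edgesIn (zdGraph d) (box d n)),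
      (e.1 ∈ liftEdges (box d N) (↑a : BondConfig ↥(box d N)) ↔ y e = true)
  swap
  · rw [if_neg ha, mul_zero, zero_mul]
    exact mul_nonneg (mul_nonneg (hw0 _) (by positivity)) (mul_nonneg (hw0 _) (by positivity))
  by_cases hb : ∀ e : ↥(edgesIn (zdGraph d) (box d n)),
      (e.1 ∈ liftEdges (box d N) (↑b : BondConfig ↥(box d N)) ↔ y' e = true)
  swap
  · rw [if_neg hb, mul_zero, mul_zero]
    exact mul_nonneg (mul_nonneg (hw0 _) (by positivity)) (mul_nonneg (hw0 _) (by positivity))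
  have hab : ∀ e : ↥(edgesIn (zdGraph d) (box d n)),
      (e.1 ∈ liftEdges (box d N) (↑(a ⊓ b) : BondConfig ↥(box d N)) ↔ (y ⊓ y') e = true) := fun e => by
    rw [Finset.inf_eq_inter, mem_liftEdges_inter_iff, inf_apply_eq_true_iff, ha e, hb e]
  have hab' : ∀ e : ↥(edgesIn (zdGraph d) (box d n)),
      (e.1 ∈ liftEdges (box d N) (↑(a ⊔ b) : BondConfig ↥(box d N)) ↔ (y ⊔ y') e = true) := fun e => by
    rw [Finset.sup_eq_union, mem_liftEdges_union_iff, sup_apply_eq_true_iff, ha e, hb e]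
  rw [if_pos ha, if_pos hb, if_pos hab, if_pos hab', mul_one, mul_one, mul_one, mul_one]
  exact rcWeight_lattice_condition G hp hq B a b

/-- THE FKG LATTICE CONDITION OF THE MARGINAL: `μ(y) μ(y') ≤ μ(y ⊓ y') μ(y ⊔ y')` for `q ≥ 1` — the four functions
theorem (Ahlswede–Daykin; Mathlib `four_functions_theorem_univ`) applied on the configuration lattice of `Λ_N` to the
random-cluster weight times the indicators of the two cylinders. [cite: Grimmett2006, Thm (3.8) and Thm (2.24) ((b): FKG lattice condition)] -/
theorem mu_lattice (hp : p ∈ Set.Icc (0 : ℝ) 1) (hq : 1 ≤ q)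
    (hμ : ∀ y, μ y = regionWiredReal d p q (box d N)
      {ω | ∀ e : ↥(edgesIn (zdGraph d) (box d n)), (e.1 ∈ ω ↔ y e = true)})
    (y y' : ↥(edgesIn (zdGraph d) (box d n)) → Bool) : μ y * μ y' ≤ μ (y ⊓ y') * μ (y ⊔ y') := by
  have hq0 : 0 < q := one_pos.trans_le hq
  have hZ := rcPartitionFunction_pos (finsetGraph (zdGraph d) (box d N)) hp hq0 (wiredBoundary (zdGraph d) (box d N))
  have hw0 : ∀ (z : ↥(edgesIn (zdGraph d) (box d n)) → Bool) (ω : Finset (Sym2 ↥(box d N))),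
      0 ≤ (if ω ⊆ (finsetGraph (zdGraph d) (box d N)).edgeFinset
          then rcWeight (finsetGraph (zdGraph d) (box d N)) p q (wiredBoundary (zdGraph d) (box d N)) ω else 0)
        * (if (∀ e : ↥(edgesIn (zdGraph d) (box d n)),
            (e.1 ∈ liftEdges (box d N) (↑ω : BondConfig ↥(box d N)) ↔ z e = true)) then (1 : ℝ) else 0) :=
    fun z ω => mul_nonneg (rcWeight_ite_nonneg _ hp hq0.le _ ω) (by positivity)
  have key := four_functions_theorem_univ
    (fun ω : Finset (Sym2 ↥(box d N)) => (if ω ⊆ (finsetGraph (zdGraph d) (box d N)).edgeFinset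
          then rcWeight (finsetGraph (zdGraph d) (box d N)) p q (wiredBoundary (zdGraph d) (box d N)) ω else 0)
        * (if (∀ e : ↥(edgesIn (zdGraph d) (box d n)),
            (e.1 ∈ liftEdges (box d N) (↑ω : BondConfig ↥(box d N)) ↔ y e = true)) then (1 : ℝ) else 0))
    (fun ω : Finset (Sym2 ↥(box d N)) => (if ω ⊆ (finsetGraph (zdGraph d) (box d N)).edgeFinset
          then rcWeight (finsetGraph (zdGraph d) (box d N)) p q (wiredBoundary (zdGraph d) (box d N)) ω else 0)
        * (if (∀ e : ↥(edgesIn (zdGraph d) (box d n)),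
            (e.1 ∈ liftEdges (box d N) (↑ω : BondConfig ↥(box d N)) ↔ y' e = true)) then (1 : ℝ) else 0))
    (fun ω : Finset (Sym2 ↥(box d N)) => (if ω ⊆ (finsetGraph (zdGraph d) (box d N)).edgeFinset
          then rcWeight (finsetGraph (zdGraph d) (box d N)) p q (wiredBoundary (zdGraph d) (box d N)) ω else 0)
        * (if (∀ e : ↥(edgesIn (zdGraph d) (box d n)),
            (e.1 ∈ liftEdges (box d N) (↑ω : BondConfig ↥(box d N)) ↔ (y ⊓ y') e = true)) then (1 : ℝ) else 0))
    (fun ω : Finset (Sym2 ↥(box d N)) => (if ω ⊆ (finsetGraph (zdGraph d) (box d N)).edgeFinset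
          then rcWeight (finsetGraph (zdGraph d) (box d N)) p q (wiredBoundary (zdGraph d) (box d N)) ω else 0)
        * (if (∀ e : ↥(edgesIn (zdGraph d) (box d n)),
            (e.1 ∈ liftEdges (box d N) (↑ω : BondConfig ↥(box d N)) ↔ (y ⊔ y') e = true)) then (1 : ℝ) else 0))
    (fun ω => hw0 y ω) (fun ω => hw0 y' ω) (fun ω => hw0 _ ω) (fun ω => hw0 _ ω)
    (fun a b => cyl_weight_four_functions hp hq y y' a b)
  simp only [sum_weight_mul_cyl μ hp hq0 hμ] at key
  have h2 : 0 < rcPartitionFunction (finsetGraph (zdGraph d) (box d N)) p q (wiredBoundary (zdGraph d) (box d N))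
      * rcPartitionFunction (finsetGraph (zdGraph d) (box d N)) p q (wiredBoundary (zdGraph d) (box d N)) := mul_pos hZ hZ
  have key' : rcPartitionFunction (finsetGraph (zdGraph d) (box d N)) p q (wiredBoundary (zdGraph d) (box d N))
      * rcPartitionFunction (finsetGraph (zdGraph d) (box d N)) p q (wiredBoundary (zdGraph d) (box d N)) * (μ y * μ y')
      ≤ rcPartitionFunction (finsetGraph (zdGraph d) (box d N)) p q (wiredBoundary (zdGraph d) (box d N))
        * rcPartitionFunction (finsetGraph (zdGraph d) (box d N)) p q (wiredBoundary (zdGraph d) (box d N))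
        * (μ (y ⊓ y') * μ (y ⊔ y')) := by
    calc _ = _ := by ring
      _ ≤ _ := key
      _ = _ := by ring
  exact le_of_mul_le_mul_left key' h2

end Cube

end MonotonicOSSS

end Summit.CriticalPhenomena.PercolationContinuityZ3.Theorems.FK
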